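import Summits.Ventures.YMGap.RobustBall.BoxSumCLT
import Summits.Ventures.YMGap.RobustBall.BoxSumCLTCylinder
import Summits.Ventures.YMGap.RobustBall.StarDoorZdGeometricCells
import HarnessLib

/-!
# Venture YMGap, track ROBUST-BALL — «C-CLT» ON THE WHOLE VERTEX-STAR WINDOW: `SU(2)` on `ℤ⁴`, EVERY `0 ≤ β_W ≤ 1/3`, uniformly
# on the star ball `MemBallZdG (3/125) (3/250) R`, and the Wilson point

HONEST FRAMING. WHAT THIS IS: a venture file (cell `pub-ymgap`, track Y2 ROBUST-BALL, seat ds-3, theorems only): the STAR-window cells of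
the object «C-CLT». Door cells IMPORTED: rb-p1's `StarDoorZdGeometricCells.su2_uniformStar_upTo_oneThird_geometric`
(`UniformMassGapOnBallZdG 4 2 (β_W/4) (3/125) (3/250) R ((1/400)/(max R 1 + 4)) 32` for every `0 ≤ β_W ≤ 1/3`) and
`su2_wilson_clustering_upTo_oneThird_explicit` (the Wilson point), ds-3's `oneState_translationInvariant_onBallZdG` /
`su2_wilson_oneState_translationInvariant`; machinery `BoxSumCLT.tendstoInDistribution_boxSum` + `BoxSumCLTCylinder`.
* ★★★ `su2_clt_onStarBall_upTo_oneThird` — `0 ≤ β_W ≤ 1/3`, EVERY member of `MemBallZdG (3/125) (3/250) R` ('t Hooft `β_W/4`) with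
  translation-covariant Hamiltonians, EVERY Lipschitz cylinder: one translation-invariant DLR state, summable autocovariance, CLT;
* ★★★ `su2_wilson_boxSum_clt_upTo_oneThird` — the Wilson point on the whole window `0 ≤ β_W ≤ 1/3` (tree coupling `β_W/2`).
WHAT THIS IS NOT: lattice strong coupling; NOT `χ > 0`, NOT an LDP, nothing spectral / continuum / Clay.
-/

noncomputable section

open MeasureTheory Filter Topology ProbabilityTheory Real
open scoped NNReal
open Literature.Probability.LatticeModels hiding configShift configShift_apply
open Literature.MathematicalPhysics.QuantumLattice
open Literature.MathematicalPhysics.QuantumFieldTheory hiding ZdEdge Site IsLocalObservable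

namespace Summit.Ventures.YMGap.RobustBall

namespace BoxSumCLT

/-- ★★★ **THE CLT ON THE STAR BALL, `SU(2)` ON `ℤ⁴`, EVERY `0 ≤ β_W ≤ 1/3`.** For every range `R`, every member `(W, supp)` of
`MemBallZdG (3/125) (3/250) R` at 't Hooft coupling `β_W/4` with translation-covariant finite-volume Hamiltonians, and every Lipschitz
cylinder `F`: one translation-invariant DLR state `μ`, `Σ_v |cov_μ(F, F∘θ_v)| < ∞`, and `(Σ_{x∈B_n} F∘θ_x − #B_n μ(F))/√#B_n → N(0, Σ_v cov_μ)`
in distribution. [folklore] -/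
theorem su2_clt_onStarBall_upTo_oneThird {βW : ℝ} (h0 : 0 ≤ βW) (h : βW ≤ 1 / 3) (R : ℕ)
    {W : Potential (ZdEdge 4) (SUN 2)} {supp : Finset (ZdEdge 4) → Finset (Finset (ZdEdge 4))}
    (hmem : MemBallZdG (3 / 125) (3 / 250) R W supp)
    (hH : ∀ (Λ : Finset (ZdEdge 4)) (v : Site 4) (U : LGConfig 4 (SUN 2)),
      hamiltonianIn W supp (Λ.map (edgeShift v).toEmbedding) (configShift v U) = hamiltonianIn W supp Λ U)
    {Ω' : Type*} [MeasurableSpace Ω'] {P' : Measure Ω'} [IsProbabilityMeasure P'] (Z : Ω' → ℝ)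
    {F : LGConfig 4 (SUN 2) → ℝ} {Δ : Finset (ZdEdge 4)} {K : ℝ≥0} (hF : IsLipschitzCylinder (fundamentalRep (Fin 2)) F Δ K) :
    ∃ μ : Measure (LGConfig 4 (SUN 2)), ∃ _ : IsProbabilityMeasure μ,
      perturbedGibbsMeasures (d := 4) (fundamentalRep (Fin 2)) ((2 : ℕ) * (βW / 4)) W supp = {μ} ∧ IsZdTranslationInvariant μ ∧
      Summable (fun v : Site 4 => |cov[F, fun U => F (configShift v U); μ]|) ∧
      (HasLaw Z (gaussianReal 0 (∑' v, cov[F, fun U => F (configShift v U); μ]).toNNReal) P' →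
        TendstoInDistribution
          (fun n U => (∑ x ∈ siteBox 4 n, F (configShift x U) - (siteBox 4 n).card * ∫ V, F V ∂μ) / Real.sqrt ((siteBox 4 n).card))
          atTop Z (fun _ => μ) P') := by
  classical
  have hball := su2_uniformStar_upTo_oneThird_geometric h0 h R
  obtain ⟨μ, hG, hinv⟩ := oneState_translationInvariant_onBallZdG hball.massGapOnBallZdG hmem hH
  have hμ : μ ∈ perturbedGibbsMeasures (d := 4) (fundamentalRep (Fin 2)) ((2 : ℕ) * (βW / 4)) W supp := by
    rw [hG]; exact Set.mem_singleton μ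
  have hμG : IsGibbsMeasure (perturbedYM (d := 4) (fundamentalRep (Fin 2)) ((2 : ℕ) * (βW / 4)) W supp) μ := hμ
  haveI := hμG.isProbabilityMeasure
  have hcl : PerturbedClustering 4 2 (βW / 4) W supp ((1 / 400 : ℝ) / (max R 1 + 4 : ℕ)) 32 := (hball.2 W supp hmem).2
  have hFm : Measurable F := hF.measurable
  have hFb : ∀ U, |F U| ≤ |F 1| + 2 * K := hF.abs_le
  set δ : ℝ := ∑ e ∈ Δ, ∑ e' ∈ Δ, ‖e.1 - e'.1‖ with hδdef
  have hδ : ∀ e ∈ Δ, ∀ e' ∈ Δ, ‖e.1 - e'.1‖ ≤ δ := fun e he e' he' =>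
    (Finset.single_le_sum (f := fun e'' : ZdEdge 4 => ‖e.1 - e''.1‖) (fun _ _ => norm_nonneg _) he').trans
      (Finset.single_le_sum (f := fun e₀ : ZdEdge 4 => ∑ e'' ∈ Δ, ‖e₀.1 - e''.1‖)
        (fun _ _ => Finset.sum_nonneg fun _ _ => norm_nonneg _) he)
  have hpair := pairClustering_of_perturbedClustering hcl hball.1.le (by norm_num) hμ hF hδ
  have hA' : (0 : ℝ) ≤ 32 * (Δ.card : ℝ) ^ 2 * Real.exp ((1 / 400 : ℝ) / (max R 1 + 4 : ℕ) * δ) * max 1 ((K : ℝ) ^ 2) := by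
    have : (0 : ℝ) ≤ max 1 ((K : ℝ) ^ 2) := le_max_of_le_left zero_le_one
    positivity
  exact ⟨μ, inferInstance, hG, hinv, summable_abs_cov_of_pairClustering (d := 4) (by norm_num) hFm hFb hball.1 hA' hpair,
    fun hZ => tendstoInDistribution_boxSum (d := 4) (by norm_num) hinv hFm hFb hball.1 hA' hpair hZ⟩

/-- ★★★ **THE WILSON POINT ON THE WHOLE STAR WINDOW `0 ≤ β_W ≤ 1/3`**: one translation-invariant DLR state of `SU(2)` lattice Yang–Mills on
`ℤ⁴` (tree coupling `β_W/2`) and, for EVERY Lipschitz cylinder `F`, summable autocovariance and the central limit theorem for the cube sums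
(door cell `su2_wilson_clustering_upTo_oneThird_explicit`: rate `1/2000`, constant `32 n²`). [folklore] -/
theorem su2_wilson_boxSum_clt_upTo_oneThird {βW : ℝ} (h0 : 0 ≤ βW) (h : βW ≤ 1 / 3)
    {Ω' : Type*} [MeasurableSpace Ω'] {P' : Measure Ω'} [IsProbabilityMeasure P'] (Z : Ω' → ℝ)
    {F : LGConfig 4 (SUN 2) → ℝ} {Δ : Finset (ZdEdge 4)} {K : ℝ≥0} (hF : IsLipschitzCylinder (fundamentalRep (Fin 2)) F Δ K) :
    ∃ μ : Measure (LGConfig 4 (SUN 2)), ∃ _ : IsProbabilityMeasure μ,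
      ymGibbsMeasures (d := 4) (fundamentalRep (Fin 2)) (βW / 2) = {μ} ∧ IsZdTranslationInvariant μ ∧
      Summable (fun v : Site 4 => |cov[F, fun U => F (configShift v U); μ]|) ∧
      (HasLaw Z (gaussianReal 0 (∑' v, cov[F, fun U => F (configShift v U); μ]).toNNReal) P' →
        TendstoInDistribution
          (fun n U => (∑ x ∈ siteBox 4 n, F (configShift x U) - (siteBox 4 n).card * ∫ V, F V ∂μ) / Real.sqrt ((siteBox 4 n).card))
          atTop Z (fun _ => μ) P') := by
  classical
  have hb : |βW / 2| ≤ 9 / 50 := by rw [abs_div, abs_two, abs_of_nonneg h0]; linarith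
  obtain ⟨μ, hG, hinv⟩ := su2_wilson_oneState_translationInvariant hb
  have hμ : μ ∈ ymGibbsMeasures (d := 4) (fundamentalRep (Fin 2)) (βW / 2) := by rw [hG]; exact Set.mem_singleton μ
  have hμG : IsGibbsMeasure (ymSpecification (d := 4) (fundamentalRep (Fin 2)) (βW / 2)) μ := hμ
  haveI := hμG.isProbabilityMeasure
  have hcl := su2_wilson_clustering_upTo_oneThird_explicit h0 h
  have hμ' : μ ∈ perturbedGibbsMeasures (d := 4) (fundamentalRep (Fin 2)) (2 * (βW / 4)) 0
      (fun _ => (∅ : Finset (Finset (ZdEdge 4)))) := by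
    rw [perturbedGibbsMeasures_zero, show (2 : ℝ) * (βW / 4) = βW / 2 by ring]; exact hμ
  have hFm : Measurable F := hF.measurable
  have hFb : ∀ U, |F U| ≤ |F 1| + 2 * K := hF.abs_le
  set δ : ℝ := ∑ e ∈ Δ, ∑ e' ∈ Δ, ‖e.1 - e'.1‖ with hδdef
  have hδ : ∀ e ∈ Δ, ∀ e' ∈ Δ, ‖e.1 - e'.1‖ ≤ δ := fun e he e' he' =>
    (Finset.single_le_sum (f := fun e'' : ZdEdge 4 => ‖e.1 - e''.1‖) (fun _ _ => norm_nonneg _) he').trans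
      (Finset.single_le_sum (f := fun e₀ : ZdEdge 4 => ∑ e'' ∈ Δ, ‖e₀.1 - e''.1‖)
        (fun _ _ => Finset.sum_nonneg fun _ _ => norm_nonneg _) he)
  have hm : (0 : ℝ) < (1 / 400 : ℝ) / 5 := by norm_num
  have hpair := pairClustering_of_perturbedClustering hcl hm.le (by norm_num) hμ' hF hδ
  have hA : (0 : ℝ) ≤ 32 * (Δ.card : ℝ) ^ 2 * Real.exp ((1 / 400 : ℝ) / 5 * δ) * max 1 ((K : ℝ) ^ 2) := by
    have : (0 : ℝ) ≤ max 1 ((K : ℝ) ^ 2) := le_max_of_le_left zero_le_one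
    positivity
  exact ⟨μ, inferInstance, hG, hinv, summable_abs_cov_of_pairClustering (d := 4) (by norm_num) hFm hFb hm hA hpair,
    fun hZ => tendstoInDistribution_boxSum (d := 4) (by norm_num) hinv hFm hFb hm hA hpair hZ⟩

end BoxSumCLT

end Summit.Ventures.YMGap.RobustBall

end
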